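import Mathlib

/-!
HONEST FRAMING: exact (Metropolis-corrected) sampling algorithms for lattice gauge theory; figures
of merit are autocorrelation/cost numbers at stated couplings and volumes; no continuum-physics
claim.

# HubChainEigenbasis — THE SWAP PHASE OF THE STAR SOLVED EXACTLY, I: THE LABELLED MIN-KERNEL HUB CHAIN `P(i,j) = c·min{1, ρ_j/ρ_i}` (`i ≠ j`) IS A METROPOLIZED INDEPENDENCE
# SAMPLER; ITS EIGENFUNCTIONS ARE `f_k = ρ_k·𝟙_{<k} − R_{<k}·𝟙_{k}`, ITS EIGENVALUES `β_k = 1 − c((m−k) + R_{<k}/ρ_k)` (INCREASING IN THE DEPTH RANK `k`), THEY ARE `ρ`-ORTHOGONAL WITH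
# `‖f_k‖²_ρ = ρ_kR_{<k}R_{≤k}`, AND COMPLETE: `δ_{ij} = ρ_j(1/R + Σ_k f_k(i)f_k(j)/(ρ_kR_{<k}R_{≤k}))` (lean-2 GEN-39, ours)

Venture-side (OURS).  Cell `lqcd-flow` (pub-lqcd), unit `pub-lqcd-lean-2-g39`, 2026-08-30.  Chapter Y (the swap phase solved exactly), file 1.  Within a refresh cycle of the
tempering star the hub holds one of `m = K+1` labelled particles and a swap attempt proposes one of the OTHER `m−1` particles uniformly and accepts with
`min{1, W_h/W_v} = min{1, ρ_v/ρ_h}` (`ρ = 1/W` the depth; chapters W∕X, MEMO-gen37 §2, MEMO-gen38 §1): the hub chain on particle labels is `P(i,j) = c·min{1, ρ_j/ρ_i}` for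
`i ≠ j` (`c = 1/K`), reversible w.r.t. `ρ`.  This is the Metropolized INDEPENDENCE sampler for the target `∝ ρ` with the uniform proposal (self excluded, an affine time change of
the textbook one), and it is exactly solvable.  With the particles enumerated by depth rank `0, 1, …, m−1` (`ρ` non-decreasing; ties allowed), `R_k = Σ_{i<k}ρ_i`:

* the function `f_k(i) = ρ_k` (`i < k`), `−R_k` (`i = k`), `0` (`i > k`) is an eigenfunction with eigenvalue `β_k = 1 − c((m−k) + R_k/ρ_k)` (`= P(k,k) − c`; `f_0 = 0`);
* `β` is non-decreasing in the rank, `1 − cm ≤ β_k ≤ 1 − c`;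
* `Σ_i ρ_if_k(i) = 0`, `Σ_iρ_if_k(i)f_l(i) = 0` (`k ≠ l`), `Σ_iρ_if_k(i)² = ρ_kR_kR_{k+1}`;
* COMPLETENESS: `ρ_j·(1/R_m + Σ_{k<m} f_k(i)f_k(j)/(ρ_kR_kR_{k+1})) = δ_{ij}` for `i, j < m` (the `k = 0` term is `0/0 = 0`).

Printed counterparts, NAMED ONLY (this is the cell's own elementary proof over Mathlib, not a citation): J. S. Liu, *Metropolized independent sampling with comparisons to rejection
sampling and importance sampling*, Statist. Comput. 6 (1996), the finite-state eigen-analysis; R. L. Smith – L. Tierney (1996), exact transition probabilities; the general-state-space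
version is row 2's `Exactness/IMHSmithTierney` (lean-1).  Here: the finite labelled chain WITH SELF-EXCLUSION, as hypothesis-equations on `ℕ`-indexed ranks (no definitions), in the
form the star's files consume (file 2: the closed `n`-step law and the closed `σ`-resolvent = the end-hub laws of chapter W).

## What is proved

* §1 kernel facts: `hubChain_min_of_le`, `hubChain_min_of_ge`, `hubChain_rowsum`, `hubChain_reversible`, `hubChain_sum_below`, `hubChain_diag`, `hubChain_diag_nonneg`.
* §2 **`hubChain_eigen`** (`Σ_j P(i,j)f_k(j) = β_kf_k(i)`), `hubChain_beta_le`, `hubChain_beta_ge`, `hubChain_beta_mono`.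
* §3 `hubChain_eigen_mean_zero`, `hubChain_eigen_normSq`, `hubChain_eigen_orth`.
* §4 `hubChain_telescope`, **`hubChain_complete`**.

Reading (no numerics implied): exact linear algebra of the swap phase; the laws it yields are in file 2.  Literature grade (cell rule): OWN, elementary; Liu 1996 ∕ Smith–Tierney
1996 named as the printed counterparts, nothing cited as a fact; no new bib keys.
-/

open Finset

namespace Summit.Ventures.LatticeQCDFlow.Scaling

section HubChainEigen
variable {m : ℕ} {ρ R β : ℕ → ℝ} {c : ℝ} {P f : ℕ → ℕ → ℝ}

/-! ### §1 The kernel -/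

/-- For a shallower start `i ≤ j` (so `ρ_i ≤ ρ_j`) the move to `j` is always accepted: `min{1, ρ_j/ρ_i} = 1`. [ours] -/
theorem hubChain_min_of_le (hρ : ∀ i, 0 < ρ i) (hmono : Monotone ρ) {i j : ℕ} (hij : i ≤ j) : min (1 : ℝ) (ρ j / ρ i) = 1 :=
  min_eq_left ((one_le_div (hρ i)).mpr (hmono hij))

/-- For a deeper start `j ≤ i` the acceptance is the ratio: `min{1, ρ_j/ρ_i} = ρ_j/ρ_i`. [ours] -/
theorem hubChain_min_of_ge (hρ : ∀ i, 0 < ρ i) (hmono : Monotone ρ) {i j : ℕ} (hji : j ≤ i) : min (1 : ℝ) (ρ j / ρ i) = ρ j / ρ i :=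
  min_eq_right ((div_le_one (hρ i)).mpr (hmono hji))

/-- Unit row sums on `range m` (from the diagonal hypothesis). [ours] -/
theorem hubChain_rowsum (hPdiag : ∀ i, P i i = 1 - ∑ j ∈ (range m).erase i, P i j) {i : ℕ} (hi : i < m) : ∑ j ∈ range m, P i j = 1 := by
  rw [← Finset.add_sum_erase _ _ (mem_range.mpr hi), hPdiag i]; ring

/-- **Reversibility** w.r.t. `ρ`: `ρ_iP(i,j) = c·min{ρ_i, ρ_j} = ρ_jP(j,i)`. [ours] -/
theorem hubChain_reversible (hρ : ∀ i, 0 < ρ i) (hPoff : ∀ i j, i ≠ j → P i j = c * min 1 (ρ j / ρ i)) (i j : ℕ) :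
    ρ i * P i j = ρ j * P j i := by
  by_cases hij : i = j
  · subst hij; rfl
  have key : ∀ a b, ρ a * min (1 : ℝ) (ρ b / ρ a) = min (ρ a) (ρ b) := by
    intro a b
    rcases le_total (ρ a) (ρ b) with h | h
    · rw [min_eq_left ((one_le_div (hρ a)).mpr h), min_eq_left h, mul_one]
    · rw [min_eq_right ((div_le_one (hρ a)).mpr h), min_eq_right h, mul_div_cancel₀ _ (hρ a).ne']
  rw [hPoff i j hij, hPoff j i (Ne.symm hij), mul_left_comm, key, mul_left_comm, key, min_comm]

/-- Splitting a sum over `range m` at a rank `k < m`: below `k`, at `k`, above `k`. [ours] -/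
theorem hubChain_split3 {k : ℕ} (hk : k < m) (g : ℕ → ℝ) :
    ∑ j ∈ range m, g j = ∑ j ∈ range k, g j + g k + ∑ j ∈ Ico (k + 1) m, g j := by
  rw [Finset.range_eq_Ico, ← Finset.sum_Ico_consecutive g (Nat.zero_le k) hk.le, Finset.sum_eq_sum_Ico_succ_bot hk, ← Finset.range_eq_Ico]
  ring

/-- From a start `i` at least as deep as every `j < k` (`k ≤ i`): `Σ_{j<k} P(i,j) = cR_k/ρ_i`. [ours] -/
theorem hubChain_sum_below (hρ : ∀ i, 0 < ρ i) (hmono : Monotone ρ) (hR : ∀ k, R k = ∑ i ∈ range k, ρ i)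
    (hPoff : ∀ i j, i ≠ j → P i j = c * min 1 (ρ j / ρ i)) {i k : ℕ} (hki : k ≤ i) :
    ∑ j ∈ range k, P i j = c * R k / ρ i := by
  rw [hR k, Finset.mul_sum, Finset.sum_div]
  refine sum_congr rfl fun j hj => ?_
  have hji : j < i := lt_of_lt_of_le (mem_range.mp hj) hki
  rw [hPoff i j (by omega), hubChain_min_of_ge hρ hmono hji.le]; ring

/-- From a start `i` shallower than `k` (`i < k ≤ m`): `Σ_{k ≤ j < m} P(i,j) = c(m−k)` (every deeper target is accepted). [ours] -/
theorem hubChain_sum_above (hρ : ∀ i, 0 < ρ i) (hmono : Monotone ρ) (hPoff : ∀ i j, i ≠ j → P i j = c * min 1 (ρ j / ρ i))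
    {i k : ℕ} (hik : i < k) : ∑ j ∈ Ico k m, P i j = c * ((m - k : ℕ) : ℝ) := by
  have : ∀ j ∈ Ico k m, P i j = c := by
    intro j hj
    have hkj : k ≤ j := (mem_Ico.mp hj).1
    rw [hPoff i j (by omega), hubChain_min_of_le hρ hmono (by omega : i ≤ j), mul_one]
  rw [sum_congr rfl this, sum_const, Nat.card_Ico, nsmul_eq_mul, mul_comm]

/-- **The diagonal:** `P(k,k) = β_k + c` with `β_k = 1 − c((m−k) + R_k/ρ_k)`, for `k < m`. [ours] -/
theorem hubChain_diag (hρ : ∀ i, 0 < ρ i) (hmono : Monotone ρ) (hR : ∀ k, R k = ∑ i ∈ range k, ρ i)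
    (hPoff : ∀ i j, i ≠ j → P i j = c * min 1 (ρ j / ρ i)) (hPdiag : ∀ i, P i i = 1 - ∑ j ∈ (range m).erase i, P i j)
    (hβ : ∀ k, β k = 1 - c * (((m - k : ℕ) : ℝ) + R k / ρ k)) {k : ℕ} (hk : k < m) : P k k = β k + c := by
  have hrow := hubChain_rowsum hPdiag hk
  rw [hubChain_split3 hk, hubChain_sum_below hρ hmono hR hPoff le_rfl, hubChain_sum_above hρ hmono hPoff (Nat.lt_succ_self k)] at hrow
  rw [hβ k]
  have e : (((m - k : ℕ) : ℝ)) = ((m - (k + 1) : ℕ) : ℝ) + 1 := by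
    rw [show m - k = (m - (k + 1)) + 1 by omega]; push_cast; ring
  rw [e]
  have : c * R k / ρ k = c * (R k / ρ k) := by ring
  rw [this] at hrow
  linarith

/-- The diagonal is non-negative as soon as `c·m ≤ 1 + c` (e.g. `c = 1/(m−1)`): `β_k ≥ 1 − cm`. [ours] -/
theorem hubChain_diag_nonneg (hρ : ∀ i, 0 < ρ i) (hmono : Monotone ρ) (hR : ∀ k, R k = ∑ i ∈ range k, ρ i)
    (hPoff : ∀ i j, i ≠ j → P i j = c * min 1 (ρ j / ρ i)) (hPdiag : ∀ i, P i i = 1 - ∑ j ∈ (range m).erase i, P i j)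
    (hβ : ∀ k, β k = 1 - c * (((m - k : ℕ) : ℝ) + R k / ρ k)) (hc : 0 ≤ c) (hcm : c * m ≤ 1 + c) {k : ℕ} (hk : k < m) : 0 ≤ P k k := by
  rw [hubChain_diag hρ hmono hR hPoff hPdiag hβ hk, hβ k]
  -- `R_k ≤ k·ρ_k`
  have hRk : R k ≤ k * ρ k := by
    rw [hR k]
    calc ∑ i ∈ range k, ρ i ≤ ∑ i ∈ range k, ρ k := sum_le_sum fun i hi => hmono (mem_range.mp hi).le
      _ = k * ρ k := by rw [sum_const, card_range, nsmul_eq_mul]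
  have h1 : R k / ρ k ≤ k := by rw [div_le_iff₀ (hρ k)]; exact hRk
  have h2 : (((m - k : ℕ) : ℝ)) + R k / ρ k ≤ m := by
    have : (((m - k : ℕ) : ℝ)) = (m : ℝ) - k := by rw [Nat.cast_sub hk.le]
    linarith
  nlinarith

/-! ### §2 The eigenfunctions -/

/-- **THE EIGEN-EQUATION.**  For every rank `k < m` and every `i < m`: `Σ_{j<m} P(i,j)f_k(j) = β_k·f_k(i)`, where `f_k(j) = ρ_k` (`j<k`), `−R_k` (`j=k`), `0` (`j>k`) and
`β_k = 1 − c((m−k) + R_k/ρ_k)`. [ours] -/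
theorem hubChain_eigen (hρ : ∀ i, 0 < ρ i) (hmono : Monotone ρ) (hR : ∀ k, R k = ∑ i ∈ range k, ρ i)
    (hPoff : ∀ i j, i ≠ j → P i j = c * min 1 (ρ j / ρ i)) (hPdiag : ∀ i, P i i = 1 - ∑ j ∈ (range m).erase i, P i j)
    (hf : ∀ k i, f k i = if i < k then ρ k else if i = k then -R k else 0)
    (hβ : ∀ k, β k = 1 - c * (((m - k : ℕ) : ℝ) + R k / ρ k)) {k i : ℕ} (hk : k < m) (hi : i < m) :
    ∑ j ∈ range m, P i j * f k j = β k * f k i := by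
  -- the sum is `ρ_k·Σ_{j<k}P(i,j) − R_k·P(i,k)`
  have hsum : ∑ j ∈ range m, P i j * f k j = ρ k * ∑ j ∈ range k, P i j - R k * P i k := by
    rw [hubChain_split3 hk]
    have h1 : ∑ j ∈ range k, P i j * f k j = ρ k * ∑ j ∈ range k, P i j := by
      rw [mul_sum]; exact sum_congr rfl fun j hj => by rw [hf, if_pos (mem_range.mp hj)]; ring
    have h2 : P i k * f k k = -(R k * P i k) := by rw [hf, if_neg (lt_irrefl k), if_pos rfl]; ring
    have h3 : ∑ j ∈ Ico (k + 1) m, P i j * f k j = 0 := by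
      refine sum_eq_zero fun j hj => ?_
      have : k + 1 ≤ j := (mem_Ico.mp hj).1
      rw [hf, if_neg (by omega), if_neg (by omega), mul_zero]
    rw [h1, h2, h3]; ring
  rw [hsum]
  rcases lt_trichotomy i k with hlt | heq | hgt
  · -- `i < k`: `Σ_{j<k}P(i,j) = 1 − c(m−k)` by the unit row sum, and `P(i,k) = c`
    have hrow := hubChain_rowsum hPdiag hi
    rw [hubChain_split3 hk, hubChain_sum_above hρ hmono hPoff (by omega : i < k + 1)] at hrow
    have hPik : P i k = c := by rw [hPoff i k (by omega), hubChain_min_of_le hρ hmono hlt.le, mul_one]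
    rw [hPik] at hrow ⊢
    have e : (((m - k : ℕ) : ℝ)) = ((m - (k + 1) : ℕ) : ℝ) + 1 := by
      rw [show m - k = (m - (k + 1)) + 1 by omega]; push_cast; ring
    rw [hf, if_pos hlt, hβ k, e]
    have : ∑ j ∈ range k, P i j = 1 - c - c * (((m - (k + 1) : ℕ) : ℝ)) := by linarith
    rw [this]
    have hρk := (hρ k).ne'
    field_simp
    ring
  · -- `i = k`
    subst heq
    rw [hubChain_sum_below hρ hmono hR hPoff le_rfl, hubChain_diag hρ hmono hR hPoff hPdiag hβ hk, hf, if_neg (lt_irrefl i), if_pos rfl, hβ i]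
    have hρk := (hρ i).ne'
    field_simp
    ring
  · -- `i > k`: both pieces are ratios and cancel
    have hPik : P i k = c * (ρ k / ρ i) := by rw [hPoff i k (by omega), hubChain_min_of_ge hρ hmono hgt.le]
    rw [hubChain_sum_below hρ hmono hR hPoff hgt.le, hPik, hf, if_neg (by omega), if_neg (by omega)]
    have hρi := (hρ i).ne'
    field_simp
    ring

/-- `β_k ≤ 1 − c` (when `c ≥ 0`). [ours] -/
theorem hubChain_beta_le (hρ : ∀ i, 0 < ρ i) (hmono : Monotone ρ) (hR : ∀ k, R k = ∑ i ∈ range k, ρ i)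
    (hβ : ∀ k, β k = 1 - c * (((m - k : ℕ) : ℝ) + R k / ρ k)) (hc : 0 ≤ c) {k : ℕ} (hk : k < m) : β k ≤ 1 - c := by
  rw [hβ k]
  have hR0 : 0 ≤ R k := by rw [hR k]; exact sum_nonneg fun i _ => (hρ i).le
  have h1 : (1 : ℝ) ≤ ((m - k : ℕ) : ℝ) := by exact_mod_cast (show 1 ≤ m - k by omega)
  have h2 : 0 ≤ R k / ρ k := div_nonneg hR0 (hρ k).le
  have _ := hmono
  nlinarith

/-- `β_k ≥ 1 − c·m` (when `c ≥ 0`). [ours] -/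
theorem hubChain_beta_ge (hρ : ∀ i, 0 < ρ i) (hmono : Monotone ρ) (hR : ∀ k, R k = ∑ i ∈ range k, ρ i)
    (hβ : ∀ k, β k = 1 - c * (((m - k : ℕ) : ℝ) + R k / ρ k)) (hc : 0 ≤ c) {k : ℕ} (hk : k < m) : 1 - c * m ≤ β k := by
  rw [hβ k]
  have hRk : R k ≤ k * ρ k := by
    rw [hR k]
    calc ∑ i ∈ range k, ρ i ≤ ∑ i ∈ range k, ρ k := sum_le_sum fun i hi => hmono (mem_range.mp hi).le
      _ = k * ρ k := by rw [sum_const, card_range, nsmul_eq_mul]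
  have h1 : R k / ρ k ≤ k := by rw [div_le_iff₀ (hρ k)]; exact hRk
  have h2 : (((m - k : ℕ) : ℝ)) = (m : ℝ) - k := by rw [Nat.cast_sub hk.le]
  nlinarith

/-- **`β` is non-decreasing in the depth rank:** `k ≤ l < m ⇒ β_k ≤ β_l` (when `c ≥ 0`). [ours] -/
theorem hubChain_beta_mono (hρ : ∀ i, 0 < ρ i) (hmono : Monotone ρ) (hR : ∀ k, R k = ∑ i ∈ range k, ρ i)
    (hβ : ∀ k, β k = 1 - c * (((m - k : ℕ) : ℝ) + R k / ρ k)) (hc : 0 ≤ c) {k l : ℕ} (hkl : k ≤ l) (hl : l < m) : β k ≤ β l := by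
  -- it suffices to compare consecutive ranks
  suffices step : ∀ j, j + 1 < m → β j ≤ β (j + 1) by
    induction l with
    | zero => rw [Nat.le_zero.mp hkl]
    | succ l ih =>
        rcases Nat.lt_or_ge k (l + 1) with h | h
        · exact (ih (by omega) (by omega)).trans (step l hl)
        · rw [le_antisymm hkl h]
  intro j hj
  rw [hβ j, hβ (j + 1), hR (j + 1), sum_range_succ, ← hR j]
  have hρj := hρ j; have hρj1 := hρ (j + 1); have hjj := hmono (Nat.le_succ j)
  have hR0 : 0 ≤ R j := by rw [hR j]; exact sum_nonneg fun i _ => (hρ i).le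
  have e1 : (((m - j : ℕ) : ℝ)) = ((m - (j + 1) : ℕ) : ℝ) + 1 := by
    rw [show m - j = (m - (j + 1)) + 1 by omega]; push_cast; ring
  rw [e1]
  -- `(R_j + ρ_j)/ρ_{j+1} ≤ R_j/ρ_j + 1`
  have key : (R j + ρ j) / ρ (j + 1) ≤ R j / ρ j + 1 := by
    rw [div_le_iff₀ hρj1]
    have : R j / ρ j * ρ (j + 1) ≥ R j := by
      have : R j / ρ j * ρ (j + 1) = R j * (ρ (j + 1) / ρ j) := by ring
      rw [this]
      exact le_mul_of_one_le_right hR0 ((one_le_div hρj).mpr hjj)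
    nlinarith
  nlinarith

/-! ### §3 Orthogonality relations -/

/-- Splitting `Σ_{i<m} ρ_i·f_k(i)·g(i)` by the support of `f_k`. [ours] -/
theorem hubChain_eigen_sum (hR : ∀ k, R k = ∑ i ∈ range k, ρ i) (hf : ∀ k i, f k i = if i < k then ρ k else if i = k then -R k else 0)
    {k : ℕ} (hk : k < m) (g : ℕ → ℝ) :
    ∑ i ∈ range m, ρ i * f k i * g i = ρ k * ∑ i ∈ range k, ρ i * g i - R k * (ρ k * g k) := by
  rw [hubChain_split3 hk]
  have h1 : ∑ i ∈ range k, ρ i * f k i * g i = ρ k * ∑ i ∈ range k, ρ i * g i := by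
    rw [mul_sum]; exact sum_congr rfl fun i hi => by rw [hf, if_pos (mem_range.mp hi)]; ring
  have h2 : ρ k * f k k * g k = -(R k * (ρ k * g k)) := by rw [hf, if_neg (lt_irrefl k), if_pos rfl]; ring
  have h3 : ∑ i ∈ Ico (k + 1) m, ρ i * f k i * g i = 0 := by
    refine sum_eq_zero fun i hi => ?_
    have : k + 1 ≤ i := (mem_Ico.mp hi).1
    rw [hf, if_neg (by omega), if_neg (by omega)]; ring
  have _ := hR
  rw [h1, h2, h3]; ring

/-- **Mean zero:** `Σ_i ρ_if_k(i) = 0`. [ours] -/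
theorem hubChain_eigen_mean_zero (hR : ∀ k, R k = ∑ i ∈ range k, ρ i) (hf : ∀ k i, f k i = if i < k then ρ k else if i = k then -R k else 0)
    {k : ℕ} (hk : k < m) : ∑ i ∈ range m, ρ i * f k i = 0 := by
  have h := hubChain_eigen_sum hR hf hk (fun _ => 1)
  simp only [mul_one] at h
  rw [h, ← hR k]; ring

/-- **The norm:** `Σ_i ρ_if_k(i)² = ρ_kR_kR_{k+1}` (`R_{k+1} = R_k + ρ_k`). [ours] -/
theorem hubChain_eigen_normSq (hR : ∀ k, R k = ∑ i ∈ range k, ρ i) (hf : ∀ k i, f k i = if i < k then ρ k else if i = k then -R k else 0)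
    {k : ℕ} (hk : k < m) : ∑ i ∈ range m, ρ i * f k i ^ 2 = ρ k * R k * R (k + 1) := by
  have h := hubChain_eigen_sum hR hf hk (f k)
  have e : ∑ i ∈ range m, ρ i * f k i ^ 2 = ∑ i ∈ range m, ρ i * f k i * f k i := sum_congr rfl fun i _ => by ring
  rw [e, h]
  have h1 : ∑ i ∈ range k, ρ i * f k i = ρ k * R k := by
    rw [hR k, mul_sum]; exact sum_congr rfl fun i hi => by rw [hf, if_pos (mem_range.mp hi)]; ring
  rw [h1, hf k k, if_neg (lt_irrefl k), if_pos rfl, hR (k + 1), sum_range_succ, ← hR k]; ring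

/-- **Orthogonality:** `Σ_i ρ_if_k(i)f_l(i) = 0` for `k ≠ l`. [ours] -/
theorem hubChain_eigen_orth (hR : ∀ k, R k = ∑ i ∈ range k, ρ i) (hf : ∀ k i, f k i = if i < k then ρ k else if i = k then -R k else 0)
    {k l : ℕ} (hk : k < m) (hl : l < m) (hkl : k ≠ l) : ∑ i ∈ range m, ρ i * f k i * f l i = 0 := by
  -- w.l.o.g. `k < l`; then `f_l = ρ_l` on the support `{i ≤ k}` of `f_k`
  wlog hlt : k < l generalizing k l
  · have h := this hl hk (Ne.symm hkl) (by omega)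
    rw [← h]; exact sum_congr rfl fun i _ => by ring
  rw [hubChain_eigen_sum hR hf hk]
  have h1 : ∑ i ∈ range k, ρ i * f l i = ρ l * R k := by
    rw [hR k, mul_sum]; exact sum_congr rfl fun i hi => by rw [hf l i, if_pos (by have := mem_range.mp hi; omega)]; ring
  rw [h1, hf l k, if_pos hlt]; ring

/-! ### §4 Completeness -/

/-- The telescoping sum over the ranks deeper than `j`: `Σ_{j<k<m} (1/R_k − 1/R_{k+1}) = 1/R_{j+1} − 1/R_m`. [ours] -/
theorem hubChain_telescope {j : ℕ} (hj : j < m) : ∑ k ∈ Ico (j + 1) m, (1 / R k - 1 / R (k + 1)) = 1 / R (j + 1) - 1 / R m := by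
  obtain ⟨d, hd⟩ : ∃ d, m = j + 1 + d := ⟨m - (j + 1), by omega⟩
  subst hd
  rw [Finset.sum_Ico_eq_sum_range, show j + 1 + d - (j + 1) = d by omega]
  clear hj
  induction d with
  | zero => simp
  | succ d ih => rw [sum_range_succ, ih, show j + 1 + (d + 1) = j + 1 + d + 1 by omega]; ring

/-- The deeper-than-`j` part of the completeness sum: `Σ_{j<k<m} f_k(i)f_k(j)/(ρ_kR_kR_{k+1}) = 1/R_{j+1} − 1/R_m` for `i ≤ j`. [ours] -/
theorem hubChain_complete_tail (hρ : ∀ i, 0 < ρ i) (hR : ∀ k, R k = ∑ i ∈ range k, ρ i)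
    (hf : ∀ k i, f k i = if i < k then ρ k else if i = k then -R k else 0) {i j : ℕ} (hij : i ≤ j) (hj : j < m) :
    ∑ k ∈ Ico (j + 1) m, f k i * f k j / (ρ k * R k * R (k + 1)) = 1 / R (j + 1) - 1 / R m := by
  rw [← hubChain_telescope hj]
  refine sum_congr rfl fun k hk => ?_
  have hk1 : j + 1 ≤ k := (mem_Ico.mp hk).1
  have hRk : 0 < R k := by
    rw [hR k]; exact sum_pos (fun i _ => hρ i) ⟨0, mem_range.mpr (by omega)⟩
  have hRk1 : R (k + 1) = R k + ρ k := by rw [hR (k + 1), sum_range_succ, ← hR k]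
  rw [hf k i, if_pos (by omega), hf k j, if_pos (by omega), hRk1]
  have hρk := hρ k
  field_simp
  ring

/-- **COMPLETENESS.**  For `i, j < m`: `ρ_j·(1/R_m + Σ_{k<m} f_k(i)f_k(j)/(ρ_kR_kR_{k+1})) = δ_{ij}` (the `k = 0` term vanishes since `f_0 = 0`; in Lean also `x/0 = 0`). [ours] -/
theorem hubChain_complete (hρ : ∀ i, 0 < ρ i) (hR : ∀ k, R k = ∑ i ∈ range k, ρ i)
    (hf : ∀ k i, f k i = if i < k then ρ k else if i = k then -R k else 0) {i j : ℕ} (hi : i < m) (hj : j < m) :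
    ρ j * (1 / R m + ∑ k ∈ range m, f k i * f k j / (ρ k * R k * R (k + 1))) = if i = j then 1 else 0 := by
  -- symmetry: the summand is symmetric in `(i,j)` apart from the prefactor; reduce to `i ≤ j`
  wlog hij : i ≤ j generalizing i j
  · have hji : j ≤ i := by omega
    have h := this hj hi hji
    rw [if_neg (by omega)] at h
    rw [if_neg (by omega)]
    -- both vanish: the bracket is zero
    have hb : 1 / R m + ∑ k ∈ range m, f k j * f k i / (ρ k * R k * R (k + 1)) = 0 := by
      rcases mul_eq_zero.mp h with h0 | h0
      · exact absurd h0 (hρ i).ne'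
      · exact h0
    rw [show (∑ k ∈ range m, f k i * f k j / (ρ k * R k * R (k + 1))) = ∑ k ∈ range m, f k j * f k i / (ρ k * R k * R (k + 1)) from
      sum_congr rfl fun k _ => by rw [mul_comm (f k i)], hb, mul_zero]
  -- split the `k`-sum at `j`: ranks `< j` contribute `0` (`f_k(j) = 0`), rank `j` the diagonal term, ranks `> j` telescope
  rw [hubChain_split3 hj, hubChain_complete_tail hρ hR hf hij hj]
  have h0 : ∑ k ∈ range j, f k i * f k j / (ρ k * R k * R (k + 1)) = 0 := by
    refine sum_eq_zero fun k hk => ?_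
    have : k < j := mem_range.mp hk
    rw [hf k j, if_neg (by omega), if_neg (by omega)]; simp
  rw [h0, zero_add]
  have hRj1 : R (j + 1) = R j + ρ j := by rw [hR (j + 1), sum_range_succ, ← hR j]
  have hρj := hρ j
  have hR0 : 0 ≤ R j := by rw [hR j]; exact sum_nonneg fun i _ => (hρ i).le
  have hRj1pos : 0 < R (j + 1) := by rw [hRj1]; linarith
  by_cases hlt : i < j
  · -- off-diagonal: the rank-`j` term is `ρ_j·(−R_j)/(ρ_jR_jR_{j+1}) = −1/R_{j+1}`
    rw [if_neg (by omega), hf j i, if_pos hlt, hf j j, if_neg (lt_irrefl j), if_pos rfl]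
    by_cases hRj : R j = 0
    · -- then `j = 0`-like degenerate: impossible since `i < j` forces `R_j ≥ ρ_i > 0`
      exfalso
      have : 0 < R j := by rw [hR j]; exact sum_pos (fun i _ => hρ i) ⟨i, mem_range.mpr hlt⟩
      linarith
    rw [hRj1]
    field_simp
    ring
  · -- diagonal
    have hieq : i = j := by omega
    subst hieq
    rw [if_pos rfl, hf i i, if_neg (lt_irrefl i), if_pos rfl, hRj1]
    by_cases hRj : R i = 0
    · rw [hRj]; simp; field_simp
    · field_simp
      ring

end HubChainEigen

end Summit.Ventures.LatticeQCDFlow.Scaling
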